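import Summits.AnomalousDissipation.AnomalousDissipation.Theorems.BaireTransferDenseLoudDesignerForcesStubBirkhoffMeans
import Literature.Dynamics.Ergodic.KrylovBogolyubovSemiflow

/-!
# Stub KB `stub_loudInvariantMeasure` of the line `ergodic-budget-selection-closing`
# (crux `BaireTransfer.DenseLoudDesignerForces`, stmt-AnomalousDissipation-1143): Krylov–Bogolyubov WITH BUDGETS

Sorry-free discharge of the registered stub `stub_loudInvariantMeasure` of the lead's skeleton v6
(`Cruxes/DenseLoudDesignerForces/Lines/ergodic_budget_selection_closing.lean`, fourth lead c3-0, 2026-08-16) over the landed line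
vocabulary `Theorems/BaireTransferDenseLoudDesignerForcesErgodicLine.lean` (namespace `…Theorems.DenseLoudDesignerForces.Ergodic`:
`Hsp`, `enstrophyObs`, `energyAvg`, `dissipAvg`, `IsNSPhase`, `IsInvariantMeasure`) and the tree's ensemble budgets
`Torus.ensembleEnergy`, `Torus.ensembleDissipation` (`Literature/Analysis/FluidPDE/StatisticalSolution.lean`).

**Statement.**  Let `(K, φ)` be an NS phase (compact forward-invariant `K ⊂ H` of smooth states, jointly continuous semiflow,
finite and `L²`-continuous enstrophy on `K`) and `x ∈ K` a LOUD TRAJECTORY: its time-mean energy `T⁻¹∫₀ᵀ‖φ_t x‖² ≤ E` for all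
large `T` and its time-mean dissipation `T⁻¹∫₀ᵀ ν‖∇φ_t x‖² ≥ ε` for arbitrarily large `T`.  Then `K` carries an invariant Borel
probability measure `μ` (invariant under every `φ_t`, `t ≥ 0`) with `ensembleEnergy μ ≤ E` and `ensembleDissipation ν μ ≥ ε`.
This is the step "a loud bounded strong trajectory gives a loud invariant measure on a compact invariant set by Krylov–Bogolyubov /
time averages (FMRT Ch. IV)" of the planner's residual, made a theorem; with it the line's residual is stated in TRAJECTORY form
(Stub 1′ of skeleton v6) and the planner's measure-form residual (Stub 1) follows.

**Proof.**  (i) Loud times `T_k ≥ k + 1` at which both budget inequalities hold (`…_aux_times`, from `Frequently.and_eventually`).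
(ii) The semiflow restricted to the compact subtype `↥K` and saturated at negative times, `ψ_s y = φ_{max(s,0)} y`, is jointly
continuous with `ψ_{s+t} = ψ_s ∘ ψ_t` (`s, t ≥ 0`); the continuous-time Krylov–Bogolyubov theorem of the literature
(`Literature.Dynamics.Ergodic.exists_invariantMeasure_tendsto_timeAverage_semiflow`: Riesz–Markov–Kakutani applied to the
generalized time averages `lim_𝒰 T_k⁻¹∫₀^{T_k} g(ψ_t x) dt` along an ultrafilter `𝒰 → ∞`, invariance by the vanishing boundary
terms) gives a `ψ`-invariant probability measure `m` on `↥K` whose integrals of continuous functions are these generalized limits.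
(iii) Its push-forward `μ` to `H` is carried by `K` and invariant: `(φ_t)_* μ = μ` through the measurable modification
`K.piecewise (φ t) id` (`Measure.map_congr`, `Measure.map_map`).  (iv) Budgets: `ensembleEnergy μ = ∫‖·‖² dm = lim_𝒰 energyAvg φ x (T_k)
≤ E`; the enstrophy is `L²`-CONTINUOUS ON `K` (`IsNSPhase.enstrophy_continuousOn`), so `(ensembleEnstrophy μ).toReal = ∫ enstrophyObs dμ`
(`stub_birkhoffMeans_aux_integral_enstrophyObs`, landed) and `ensembleDissipation ν μ = lim_𝒰 dissipAvg ν φ x (T_k) ≥ ε`.  No sign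
condition on `ν` and no PDE is used beyond the interface `IsNSPhase`.

References: N. Kryloff, N. Bogoliouboff, Ann. of Math. 38 (1937) 65–113; Foias–Manley–Rosa–Temam, *Navier–Stokes Equations and
Turbulence* (CUP 2001) Ch. IV §2.1 Def. 2.1, §3.1 Prop. 3.1 (time-average measures are stationary statistical solutions), Ch. V §1
(ensemble averages).
-/

set_option linter.dupNamespace false

noncomputable section

open scoped BigOperators Topology ENNReal InnerProductSpace
open Filter Set Function MeasureTheory

namespace Summit.AnomalousDissipation.AnomalousDissipation.Theorems.DenseLoudDesignerForces.Ergodic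

open Literature.Analysis.FunctionSpaces Literature.Analysis.FunctionSpaces.Torus
open Literature.Analysis.FluidPDE Literature.Analysis.FluidPDE.Torus
open Summit.AnomalousDissipation.AnomalousDissipation.Theses.BaireTransfer
open Summit.AnomalousDissipation.AnomalousDissipation.Theorems.DenseLoudDesignerForces.Negative

/-! ## Krylov–Bogolyubov with budgets (Stub KB of skeleton v6) -/

section LoudInvariantMeasure

variable {ν : ℝ} {F : (UnitAddTorus (Fin 3)) → (EuclideanSpace ℝ (Fin 3))} {K : Set Hsp} {φ : ℝ → Hsp → Hsp}

/-- **Loud times.**  If `P` holds for all large real times and `Q` for arbitrarily large ones, there are times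
`T_k ≥ k + 1` at which both hold. [folklore] -/
theorem stub_loudInvariantMeasure_aux_times {P Q : ℝ → Prop} (hP : ∀ᶠ T in atTop, P T) (hQ : ∃ᶠ T in atTop, Q T) :
    ∃ T : ℕ → ℝ, (∀ k : ℕ, (k : ℝ) + 1 ≤ T k) ∧ (∀ k, P (T k)) ∧ ∀ k, Q (T k) := by
  have h : ∃ᶠ T in atTop, Q T ∧ P T := hQ.and_eventually hP
  rw [frequently_atTop] at h
  choose T hT hPQ using fun k : ℕ => h ((k : ℝ) + 1)
  exact ⟨T, hT, fun k => (hPQ k).2, fun k => (hPQ k).1⟩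

/-- **The semiflow on the compact carrier.**  The restriction of `φ` to the subtype `↥K`, saturated at negative times
(`s ↦ max s 0`), is jointly continuous on `ℝ × ↥K` and satisfies the semigroup law for `s, t ≥ 0`. [folklore] -/
theorem stub_loudInvariantMeasure_aux_semiflow (hK : IsNSPhase ν F K φ) :
    Continuous (fun q : ℝ × ↥K =>
      (⟨φ (max q.1 0) (q.2 : Hsp), hK.mapsTo _ (le_max_right _ _) q.2.2⟩ : ↥K)) ∧
    ∀ s t : ℝ, 0 ≤ s → 0 ≤ t → ∀ y : ↥K,
      (⟨φ (max (s + t) 0) (y : Hsp), hK.mapsTo _ (le_max_right _ _) y.2⟩ : ↥K) =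
        ⟨φ (max s 0) ((⟨φ (max t 0) (y : Hsp), hK.mapsTo _ (le_max_right _ _) y.2⟩ : ↥K) : Hsp),
          hK.mapsTo _ (le_max_right _ _) (hK.mapsTo _ (le_max_right _ _) y.2)⟩ := by
  constructor
  · have h1 : Continuous fun q : ℝ × ↥K => ((max q.1 0, (q.2 : Hsp)) : ℝ × Hsp) := by fun_prop
    have h2 : ∀ q : ℝ × ↥K, ((max q.1 0, (q.2 : Hsp)) : ℝ × Hsp) ∈ Ici (0 : ℝ) ×ˢ K :=
      fun q => mk_mem_prod (mem_Ici.2 (le_max_right _ _)) q.2.2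
    exact (hK.continuousOn.comp_continuous h1 h2).subtype_mk _
  · intro s t hs ht y
    apply Subtype.ext
    simp only [max_eq_left hs, max_eq_left ht, max_eq_left (add_nonneg hs ht)]
    exact hK.map_add s t hs ht _ y.2

/-- **Push-forward of an invariant measure on the carrier.**  If `m` is a probability measure on `↥K` invariant under the
restricted time-`t` maps for all `t ≥ 0`, its image in `H` is an invariant probability measure carried by `K`
(`IsInvariantMeasure`), the time-`t` map `φ t` being replaced by its Borel measurable modification `K.piecewise (φ t) id`.
[folklore] -/
theorem stub_loudInvariantMeasure_aux_pushforward (hK : IsNSPhase ν F K φ) {m : Measure ↥K} (hm : IsProbabilityMeasure m)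
    (hinv : ∀ t : ℝ, 0 ≤ t → Measure.map (fun y : ↥K =>
      (⟨φ (max t 0) (y : Hsp), hK.mapsTo _ (le_max_right _ _) y.2⟩ : ↥K)) m = m) :
    IsInvariantMeasure K φ (Measure.map ((↑) : ↥K → Hsp) m) := by
  classical
  have hKm : MeasurableSet K := hK.isCompact.isClosed.measurableSet
  have hval : Measurable ((↑) : ↥K → Hsp) := measurable_subtype_coe
  haveI : IsProbabilityMeasure (Measure.map ((↑) : ↥K → Hsp) m) := Measure.isProbabilityMeasure_map hval.aemeasurable
  have hnull : Measure.map ((↑) : ↥K → Hsp) m Kᶜ = 0 := by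
    rw [Measure.map_apply hval hKm.compl]
    have : ((↑) : ↥K → Hsp) ⁻¹' Kᶜ = ∅ := by
      ext y
      simp only [mem_preimage, mem_compl_iff, Subtype.coe_prop, not_true_eq_false, mem_empty_iff_false]
    rw [this, measure_empty]
  refine ⟨inferInstance, hnull, fun t ht => ?_⟩
  have hψ := stub_loudInvariantMeasure_aux_semiflow hK
  -- the restricted time-`t` map is continuous, hence measurable
  have hψt : Measurable fun y : ↥K => (⟨φ (max t 0) (y : Hsp), hK.mapsTo _ (le_max_right _ _) y.2⟩ : ↥K) := by
    have h0 : Continuous fun y : ↥K => ((t, y) : ℝ × ↥K) := by fun_prop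
    exact (hψ.1.comp h0).measurable
  -- a measurable modification of `φ t` agreeing with it on `K`, hence a.e.
  have hct : ContinuousOn (φ t) K := by
    have h0 : Continuous fun y : Hsp => ((t, y) : ℝ × Hsp) := by fun_prop
    exact hK.continuousOn.comp h0.continuousOn fun y hy => ⟨ht, hy⟩
  have hf : Measurable (K.piecewise (φ t) id) := hct.measurable_piecewise continuousOn_id hKm
  have hae_mem : ∀ᵐ y ∂(Measure.map ((↑) : ↥K → Hsp) m), y ∈ K := by
    have h : Measure.map ((↑) : ↥K → Hsp) m {y | ¬ y ∈ K} = 0 := hnull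
    exact ae_iff.2 h
  have hae : φ t =ᵐ[Measure.map ((↑) : ↥K → Hsp) m] K.piecewise (φ t) id :=
    hae_mem.mono fun y hy => (piecewise_eq_of_mem _ _ _ hy).symm
  have hcomp : (K.piecewise (φ t) id) ∘ ((↑) : ↥K → Hsp) =
      ((↑) : ↥K → Hsp) ∘ fun y : ↥K => (⟨φ (max t 0) (y : Hsp), hK.mapsTo _ (le_max_right _ _) y.2⟩ : ↥K) := by
    funext y
    simp only [comp_apply, piecewise_eq_of_mem _ _ _ y.2, max_eq_left ht]
  calc Measure.map (φ t) (Measure.map ((↑) : ↥K → Hsp) m)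
      = Measure.map (K.piecewise (φ t) id) (Measure.map ((↑) : ↥K → Hsp) m) := Measure.map_congr hae
    _ = Measure.map ((K.piecewise (φ t) id) ∘ ((↑) : ↥K → Hsp)) m := Measure.map_map hf hval
    _ = Measure.map (((↑) : ↥K → Hsp) ∘ fun y : ↥K =>
          (⟨φ (max t 0) (y : Hsp), hK.mapsTo _ (le_max_right _ _) y.2⟩ : ↥K)) m := by rw [hcomp]
    _ = Measure.map ((↑) : ↥K → Hsp) (Measure.map (fun y : ↥K =>
          (⟨φ (max t 0) (y : Hsp), hK.mapsTo _ (le_max_right _ _) y.2⟩ : ↥K)) m) := (Measure.map_map hval hψt).symm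
    _ = Measure.map ((↑) : ↥K → Hsp) m := by rw [hinv t ht]

/-- Integrals against the push-forward of `m` of observables continuous on `K` are integrals against `m` on the carrier.
[folklore] -/
theorem stub_loudInvariantMeasure_aux_integral_map (hK : IsNSPhase ν F K φ) (m : Measure ↥K)
    {g : Hsp → ℝ} (hg : ContinuousOn g K) :
    ∫ y, g y ∂(Measure.map ((↑) : ↥K → Hsp) m) = ∫ y, g (y : Hsp) ∂m := by
  have hKm : MeasurableSet K := hK.isCompact.isClosed.measurableSet
  have hval : Measurable ((↑) : ↥K → Hsp) := measurable_subtype_coe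
  have hnull : Measure.map ((↑) : ↥K → Hsp) m {y | ¬ y ∈ K} = 0 := by
    rw [show {y : Hsp | ¬ y ∈ K} = Kᶜ from rfl, Measure.map_apply hval hKm.compl]
    have : ((↑) : ↥K → Hsp) ⁻¹' Kᶜ = ∅ := by
      ext y
      simp only [mem_preimage, mem_compl_iff, Subtype.coe_prop, not_true_eq_false, mem_empty_iff_false]
    rw [this, measure_empty]
  have hres : (Measure.map ((↑) : ↥K → Hsp) m).restrict K = Measure.map ((↑) : ↥K → Hsp) m :=
    Measure.restrict_eq_self_of_ae_mem (ae_iff.2 hnull)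
  have hgm : AEStronglyMeasurable g (Measure.map ((↑) : ↥K → Hsp) m) := by
    rw [← hres]
    exact hg.aestronglyMeasurable hKm
  exact integral_map hval.aemeasurable hgm

/-- **Stub KB of the line `ergodic-budget-selection-closing`: KRYLOV–BOGOLYUBOV WITH BUDGETS for an NS phase.**  If a trajectory
of the NS phase `(K, φ)` starting at `x ∈ K` has time-mean energy `T⁻¹∫₀ᵀ‖φ_t x‖² ≤ E` for all large `T` and time-mean dissipation
`T⁻¹∫₀ᵀ ν‖∇φ_t x‖² ≥ ε` for arbitrarily large `T`, then `K` carries an invariant probability measure `μ` (invariant under every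
`φ_t`, `t ≥ 0`) with `ensembleEnergy μ ≤ E` and `ensembleDissipation ν μ ≥ ε`: generalized time averages along loud times
(Riesz–Markov–Kakutani on the compact carrier, invariance by the vanishing boundary terms), budgets through the `L²`-continuity of
the energy and of the enstrophy on `K`.  No sign condition on `ν`.
[cite: FMRTTurbulence2001, Ch. IV §2.1 Def. 2.1, §3.1 Prop. 3.1 (time-average measures are stationary statistical solutions)] -/
theorem stub_loudInvariantMeasure {ν : ℝ} {F : (UnitAddTorus (Fin 3)) → (EuclideanSpace ℝ (Fin 3))} {K : Set Hsp}
    {φ : ℝ → Hsp → Hsp} (hK : IsNSPhase ν F K φ) {x : Hsp} (hx : x ∈ K) {E ε : ℝ}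
    (hE : ∀ᶠ T in atTop, energyAvg φ x T ≤ E) (hε : ∃ᶠ T in atTop, ε ≤ dissipAvg ν φ x T) :
    ∃ μ : Measure Hsp, IsInvariantMeasure K φ μ ∧ ensembleEnergy μ ≤ E ∧ ε ≤ ensembleDissipation ν μ := by
  classical
  -- (i) loud times
  obtain ⟨T, hTk, hET, hεT⟩ := stub_loudInvariantMeasure_aux_times hE hε
  have hTpos : ∀ k, 0 < T k := fun k => by
    have h1 := hTk k
    have h2 : (0 : ℝ) ≤ k := Nat.cast_nonneg k
    linarith
  have hTlim : Tendsto T atTop atTop :=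
    tendsto_atTop_mono hTk (tendsto_atTop_add_const_right _ 1 tendsto_natCast_atTop_atTop)
  -- (ii) Krylov–Bogolyubov on the compact carrier along an ultrafilter
  haveI : CompactSpace ↥K := isCompact_iff_compactSpace.1 hK.isCompact
  obtain ⟨hψc, hψadd⟩ := stub_loudInvariantMeasure_aux_semiflow hK
  set ψ : ℝ → ↥K → ↥K := fun s y => ⟨φ (max s 0) (y : Hsp), hK.mapsTo _ (le_max_right _ _) y.2⟩ with hψdef
  have hψcont : ContinuousOn (fun q : ℝ × ↥K => ψ q.1 q.2) (Ici 0 ×ˢ univ) := hψc.continuousOn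
  set 𝒰 : Ultrafilter ℕ := Ultrafilter.of atTop with h𝒰def
  have h𝒰 : (𝒰 : Filter ℕ) ≤ atTop := Ultrafilter.of_le _
  obtain ⟨m, hm, hinv, hint⟩ :=
    Literature.Dynamics.Ergodic.exists_invariantMeasure_tendsto_timeAverage_semiflow hψcont hψadd ⟨x, hx⟩ hTpos hTlim h𝒰
  -- (iii) push forward to `H`
  have hμ : IsInvariantMeasure K φ (Measure.map ((↑) : ↥K → Hsp) m) :=
    stub_loudInvariantMeasure_aux_pushforward hK hm hinv
  refine ⟨Measure.map ((↑) : ↥K → Hsp) m, hμ, ?_, ?_⟩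
  · -- (iv-a) energy budget: `ensembleEnergy μ = lim_𝒰 energyAvg φ x (T k) ≤ E`
    have hobs : ContinuousOn (fun y : Hsp => ‖y‖ ^ 2) K := (continuous_norm.pow 2).continuousOn
    have h1 : ensembleEnergy (Measure.map ((↑) : ↥K → Hsp) m) = ∫ y, ‖(y : Hsp)‖ ^ 2 ∂m :=
      stub_loudInvariantMeasure_aux_integral_map hK m hobs
    have h2 := hint (fun y : ↥K => ‖(y : Hsp)‖ ^ 2) (by fun_prop)
    have h3 : ∀ k, (T k)⁻¹ * ∫ t in (0 : ℝ)..T k, ‖(ψ t ⟨x, hx⟩ : Hsp)‖ ^ 2 = energyAvg φ x (T k) := by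
      intro k
      unfold energyAvg
      congr 1
      refine intervalIntegral.integral_congr fun t ht => ?_
      rw [uIcc_of_le (hTpos k).le] at ht
      simp only [hψdef, max_eq_left ht.1]
    rw [h1]
    exact le_of_tendsto' h2 fun k => (h3 k).symm ▸ hET k
  · -- (iv-b) dissipation budget: `ensembleDissipation ν μ = lim_𝒰 dissipAvg ν φ x (T k) ≥ ε`
    have hobs : ContinuousOn (fun y : Hsp => ν * enstrophyObs y) K :=
      continuousOn_const.mul hK.enstrophy_continuousOn
    have h1 : ensembleDissipation ν (Measure.map ((↑) : ↥K → Hsp) m) = ∫ y, ν * enstrophyObs (y : Hsp) ∂m := by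
      rw [← stub_loudInvariantMeasure_aux_integral_map hK m hobs, integral_const_mul, ensembleDissipation,
        stub_birkhoffMeans_aux_integral_enstrophyObs hK hμ]
    have hcont : Continuous fun y : ↥K => ν * enstrophyObs (y : Hsp) :=
      continuous_const.mul (hK.enstrophy_continuousOn.comp_continuous continuous_subtype_val fun y => y.2)
    have h2 := hint (fun y : ↥K => ν * enstrophyObs (y : Hsp)) hcont
    have h3 : ∀ k, (T k)⁻¹ * ∫ t in (0 : ℝ)..T k, ν * enstrophyObs (ψ t ⟨x, hx⟩ : Hsp) = dissipAvg ν φ x (T k) := by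
      intro k
      unfold dissipAvg
      congr 1
      refine intervalIntegral.integral_congr fun t ht => ?_
      rw [uIcc_of_le (hTpos k).le] at ht
      simp only [hψdef, max_eq_left ht.1]
    rw [h1]
    exact ge_of_tendsto' h2 fun k => (h3 k).symm ▸ hεT k

end LoudInvariantMeasure

end Summit.AnomalousDissipation.AnomalousDissipation.Theorems.DenseLoudDesignerForces.Ergodic

end
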